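import Summits.QuantumFields.BalabanUV.T4Continuum.Support.NE7ConstrainedGreenGaugeSplit
import HarnessLib

/-!
# NE7ConstrainedGreenBalabanGauge — IN BAŁABAN's OWN GAUGE THE TRANSFER «hard slice ⟸ soft rows» IS ONE-TERM: for the soft operator
# `S = S₀ + D·R·Dᵀ + Qᵀ·A·Q` (Hessian + PROJECTED gauge fixing + penalty, [B9] (3.26)'s `Δ_a(U) = Δ(U) + D R(U) D* + a Q*Q` shape) every
# hard-slice solution `x ∈ ker Q` IN THE GAUGE `R(Dᵀx) = 0` with `S₀x = h + Qᵀμ` IS `x = C h` EXACTLY (`C = G − GQᵀ(QGQᵀ)⁻¹QG`); and a field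
# reached from `x` by a gauge move `λ` into that slice-and-gauge is `x = C h″ − Dλ` (file 96 of the curved (APE), F166; pure linear algebra, Mathlib + F151∕(140) only)

Cell `pub-balaban`, rung (B)+1 sub-cell t4, lineage `b2b-balaban-t4-ne7-p1` (CRUX PROVER NE7 #1 = OWNER of row NE7), generation 83; memo
`t4/b2b-balaban-t4-ne7-p1-g83/BALABAN-GAUGE-ROAD.md` §2.  Over F151 `NE7ConstrainedGreenGaugeSplit.eq_source_add_gaugeFix` (`x = C h + C D(Dᵀx)` for the
FULL gauge-fixing term `D·Dᵀ`) and lineage #2's (140) `NE7ConstrainedGreenIdentity.constrainedGreen` BY NAME.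
WHY.  Gen 82's transfer (F151∕F152) went through the full Landau term `D·Dᵀ` and produced a FOUR-term letter whose divergence row `‖curl∘C∘D‖` is a genuine
analytic row of the soft operator (O(1) at best, memo §1 (N2)).  Print never pays it: [B9] §3 fixes the gauge with a PROJECTION `R` (divergence covariantly
blockwise-constant is free, the rest is penalised), and a field brought INTO that gauge has `R(Dᵀx) = 0`, so the gauge-fixing term VANISHES ON IT and the
multiplier and the penalty drop as before: ONE term.  The price of REACHING the gauge (and Bałaban's straight slice `ker Q`, `Q = QbarIter`) from the END's
contour-tangent field is a gauge parameter `λ` — paid OUTSIDE the soft operator, by `curl_W(D_Wλ) = λ − Ad(hol)λ` (`NE3CurlOfGaugeDir.curlAt_gaugeDir`) and the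
tension identities (`NE7HessGaugeDirLeftGeneral.hess_gaugeDir_left`), with smallness `x`, `g_W` of the class (memo §3).  THIS file is the exact algebra of both
statements; the analytic letter left is the CURL ROW of `C` alone (memo §4: [B9] Thm 3.3 TYPE, NE9's rows).
WHAT ([folklore]; Mathlib-only linear algebra over a commutative ring; 0 def, 0 sorry).  §1 **`eq_source_of_gaugeFixed`** — `S y = S₀y + D(R(Dᵀy)) + Qᵀ(A(Qy))`,
`G·S = id`, `(QGQᵀ)⁻¹·(QGQᵀ) = id`, `Qx = 0`, `R(Dᵀx) = 0`, `S₀x = h + Qᵀμ` ⟹ `x = C h`; §2 **`eq_source_sub_gauge_of_regauged`** — for ANY `x` and a gauge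
parameter `λ` with `Q(x + Dλ) = 0`, `R(Dᵀ(x + Dλ)) = 0` and the Lagrange form `S₀(x + Dλ) = h″ + Qᵀμ` OF THE MOVED FIELD (its source `h″` carries the tension
`S₀(Dλ)` and the test transport): `x = C h″ − Dλ`; §3 **`eq_threeTerm_of_regauge`** — when the ORIGINAL field's multiplier is already in `range Qᵀ`
(`S₀x = h + Qᵀμ`): `x = C h + C(S₀(Dλ)) − Dλ` — source ∕ tension ∕ pure gauge; §4 `add_gauge_sub_constrainedGreen_eq_zero` — the weak reading `x + Dλ − C h″ = 0`.
HONEST FRAMING (page 1): [folklore] ring algebra of linear maps; NO estimate; the invertibility hypotheses are HYPOTHESES (positivity of Bałaban's `Δ_a(W)` on the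
slice — [B9] Thm 3.11 TYPE — is NOT typed here); nothing of Bałaban's asserted; (c₁) NOT proved; NOT (APE), NOT ONE-STEP, NOT NE7; spine 0∕9; finite T⁴ rung (B)+1 —
NOT infinite volume, NOT mass gap, NOT `BetaPertH`, NOT Clay.  Continuum YM on T⁴ ⇐ BetaPertH ∧ nine spine estimates (0/9 proved); BetaPertH ⇐ (D1) ∧ (D4) ∧ CAP+tail;
G-an2-4 gates asym, D1 and NE2/3/4.
-/

set_option autoImplicit false

namespace Summit.QuantumFields.BalabanUV.T4Continuum.NE7ConstrainedGreenBalabanGauge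

open NE7ConstrainedGreenIdentity (constrainedGreen)
open NE7ConstrainedGreenGaugeSplit (eq_source_add_gaugeFix)

variable {R : Type*} [CommRing R] {E F Sc : Type*} [AddCommGroup E] [Module R E] [AddCommGroup F] [Module R F] [AddCommGroup Sc] [Module R Sc]

/-! ## §1 In the gauge `R(Dᵀx) = 0` the hard-slice solution is `C h` — one term -/

/-- **THE ONE-TERM TRANSFER IDENTITY IN BAŁABAN's GAUGE.**  Let `S = S₀ + D·Rp·Dᵀ + Qᵀ·A·Q` (Hessian + projected gauge fixing + penalty) with a left Green
operator `G` (`G·S = id`) and a left inverse `Dinv` of `QGQᵀ`.  If `x ∈ ker Q` is gauge-fixed, `Rp (Dᵀ x) = 0`, and solves the hard-slice equation in Lagrange form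
`S₀ x = h + Qᵀ μ`, then `x = C h` — the gauge-fixing term vanishes ON `x`, the penalty and the multiplier drop. [folklore] -/
theorem eq_source_of_gaugeFixed (S S₀ G : E →ₗ[R] E) (Q : E →ₗ[R] F) (Qt : F →ₗ[R] E) (A Dinv : F →ₗ[R] F) (D : Sc →ₗ[R] E)
    (Rp : Sc →ₗ[R] Sc) (Dt : E →ₗ[R] Sc)
    (hS : ∀ y : E, S y = S₀ y + D (Rp (Dt y)) + Qt (A (Q y))) (hGS : ∀ y : E, G (S y) = y) (hD' : ∀ f : F, Dinv (Q (G (Qt f))) = f)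
    {x h : E} {μ : F} (hx : Q x = 0) (hgauge : Rp (Dt x) = 0) (hsrc : S₀ x = h + Qt μ) :
    x = constrainedGreen G Q Qt Dinv h := by
  have hS' : ∀ y : E, S y = S₀ y + D ((Rp ∘ₗ Dt) y) + Qt (A (Q y)) := fun y => by
    rw [LinearMap.comp_apply]; exact hS y
  have h1 := eq_source_add_gaugeFix S S₀ G Q Qt A Dinv D (Rp ∘ₗ Dt) hS' hGS hD' hx hsrc
  rwa [LinearMap.comp_apply, hgauge, map_zero, map_zero, add_zero] at h1

/-! ## §2 Reaching the slice-and-gauge by a gauge move: `x = C h″ − D λ` -/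

/-- **A FIELD MOVED INTO BAŁABAN's SLICE-AND-GAUGE.**  For ANY `x` and a gauge parameter `λ` such that the moved field `x + Dλ` is on the slice (`Q(x + Dλ) = 0`),
in the gauge (`Rp(Dᵀ(x + Dλ)) = 0`), and solves the hard-slice equation in Lagrange form `S₀(x + Dλ) = h″ + Qᵀμ` (the source `h″` of the MOVED field: it carries the
tension `S₀(Dλ)` and whatever the test transport adds), one has `x = C h″ − D λ`: after `curl_W`, the curl row of `C` on `h″` plus `ad(flux)·λ`. [folklore] -/
theorem eq_source_sub_gauge_of_regauged (S S₀ G : E →ₗ[R] E) (Q : E →ₗ[R] F) (Qt : F →ₗ[R] E) (A Dinv : F →ₗ[R] F) (D : Sc →ₗ[R] E)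
    (Rp : Sc →ₗ[R] Sc) (Dt : E →ₗ[R] Sc)
    (hS : ∀ y : E, S y = S₀ y + D (Rp (Dt y)) + Qt (A (Q y))) (hGS : ∀ y : E, G (S y) = y) (hD' : ∀ f : F, Dinv (Q (G (Qt f))) = f)
    {x h'' : E} {μ : F} {lam : Sc} (hx : Q (x + D lam) = 0) (hgauge : Rp (Dt (x + D lam)) = 0) (hsrc : S₀ (x + D lam) = h'' + Qt μ) :
    x = constrainedGreen G Q Qt Dinv h'' - D lam := by
  have h1 := eq_source_of_gaugeFixed S S₀ G Q Qt A Dinv D Rp Dt hS hGS hD' hx hgauge hsrc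
  rw [← h1, add_sub_cancel_right]

/-! ## §3 When the original multiplier is already in `range Qᵀ`: the three terms source ∕ tension ∕ pure gauge -/

/-- **THE THREE-TERM IDENTITY.**  If the ORIGINAL field already solves `S₀ x = h + Qᵀμ` (multiplier in `range Qᵀ` — e.g. when the hard slice and the soft
penalty use the SAME average) and `λ` moves it into the slice-and-gauge (`Q(x + Dλ) = 0`, `Rp(Dᵀ(x + Dλ)) = 0`), then
`x = C h + C(S₀(Dλ)) − Dλ` — source, tension (`S₀(Dλ) = hess_W(D_Wλ, ·)`, a first-variation term), pure gauge. [folklore] -/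
theorem eq_threeTerm_of_regauge (S S₀ G : E →ₗ[R] E) (Q : E →ₗ[R] F) (Qt : F →ₗ[R] E) (A Dinv : F →ₗ[R] F) (D : Sc →ₗ[R] E)
    (Rp : Sc →ₗ[R] Sc) (Dt : E →ₗ[R] Sc)
    (hS : ∀ y : E, S y = S₀ y + D (Rp (Dt y)) + Qt (A (Q y))) (hGS : ∀ y : E, G (S y) = y) (hD' : ∀ f : F, Dinv (Q (G (Qt f))) = f)
    {x h : E} {μ : F} {lam : Sc} (hx : Q (x + D lam) = 0) (hgauge : Rp (Dt (x + D lam)) = 0) (hsrc : S₀ x = h + Qt μ) :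
    x = constrainedGreen G Q Qt Dinv h + constrainedGreen G Q Qt Dinv (S₀ (D lam)) - D lam := by
  have hsrc' : S₀ (x + D lam) = (h + S₀ (D lam)) + Qt μ := by rw [map_add, hsrc]; abel
  have h1 := eq_source_sub_gauge_of_regauged S S₀ G Q Qt A Dinv D Rp Dt hS hGS hD' hx hgauge hsrc'
  rwa [map_add] at h1

/-! ## §4 Weak reading -/

/-- **WEAK READING** (consistency): under §2's hypotheses the moved field IS the constrained Green image of its own source, `x + Dλ − C h″ = 0` — so every
estimate of `curl_W x` is the curl row of `C` on `h″` plus the curl of a pure gauge, and nothing else. [folklore] -/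
theorem add_gauge_sub_constrainedGreen_eq_zero (S S₀ G : E →ₗ[R] E) (Q : E →ₗ[R] F) (Qt : F →ₗ[R] E) (A Dinv : F →ₗ[R] F) (D : Sc →ₗ[R] E)
    (Rp : Sc →ₗ[R] Sc) (Dt : E →ₗ[R] Sc)
    (hS : ∀ y : E, S y = S₀ y + D (Rp (Dt y)) + Qt (A (Q y))) (hGS : ∀ y : E, G (S y) = y) (hD' : ∀ f : F, Dinv (Q (G (Qt f))) = f)
    {x h'' : E} {μ : F} {lam : Sc} (hx : Q (x + D lam) = 0) (hgauge : Rp (Dt (x + D lam)) = 0) (hsrc : S₀ (x + D lam) = h'' + Qt μ) :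
    x + D lam - constrainedGreen G Q Qt Dinv h'' = 0 := by
  rw [eq_source_sub_gauge_of_regauged S S₀ G Q Qt A Dinv D Rp Dt hS hGS hD' hx hgauge hsrc, sub_add_cancel, sub_self]

end Summit.QuantumFields.BalabanUV.T4Continuum.NE7ConstrainedGreenBalabanGauge
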